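import Literature.MathematicalPhysics.QuantumFieldTheory.BalabanImbrieJaffe1984to88.BIJ85Ineq722Torus
import Literature.MathematicalPhysics.QuantumFieldTheory.BalabanImbrieJaffe1984to88.BIJ85Ineq724Proof
import Literature.MathematicalPhysics.QuantumFieldTheory.Balaban1983to89.B6SectAOntoV1

/-!
# `BalabanImbrieJaffe1984to88.BIJ85Ineq724Torus` — T. Bałaban, J. Imbrie, A. Jaffe, *Renormalization of the Higgs model: minimizers,
propagators and the stability of mean field theory*, Commun. Math. Phys. **97** (1985) 299–329 [BalabanImbrieJaffe1985]: Sect. 7.2 p. 326,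
**(7.2.4) ON THE TORUS FROM (7.2.2) ON THE TORUS** — the knitting of the two landed halves of the printed sentence *"This estimate follows
from (5.1.4) and (7.2.2)"*: `…BIJ85Ineq724Proof` (seat p08: `D_k(x, b) := λ(H_k(·; b))(x)` computed from (5.1.13), `abs_Dk_le` / `ineq724_block`
/ `ineq724` = `KernelData.Ineq724` GIVEN the `|H|`-member of (7.2.2) as the displayed hypothesis `hH`) and `…BIJ85Ineq722Torus` (this seat:
the `|H|`-member of (7.2.2) PROVED for the torus kernel `H_k = GQ^*(QGQ^*)⁻¹` of [6I] (1.103) modulo the analytic inputs of [6I]).  Result: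
`KernelData.Ineq724` for p08's carrier WITH THE TORUS KERNEL `H_k`, given only `TorusHyps` + the Prop. 1.2 members — and, with the (1.18)
averaging operators (`stdData`), GIVEN ONLY `G_k` symmetric ([6I] Prop. 1.1), the lower bound (1.100), and [6I] Prop. 1.2.

statement-level skeleton of published theorems with citation tags; proofs where landed; nothing here is a claim about the Yang–Mills mass gap

PDF held: `paper:balaban1985-cmp97-bij-higgs-minimizers` (journal page = PDF page + 298; pp. 325–326 = PDF 27–28); text layer read this session.

CITATION HEADER (lean-in-tree rule).  Part of the lit-balaban TYPED SKELETON (HOME `run/shared/lean/pub/lit-balaban/`), Phase-2 seat p09 gen 4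
(own lane C1 §7.2, free target after row C1.Eq7.2.1-7.2.2); row **C1.Eq7.2.4** of `HOME/SKELETON.md` (typed `…BIJ85Sect7Statements.KernelData.Ineq724`
p239582; MODEL INSTANCE `…BIJ85Ineq724Proof.ineq724` p248563, seat p08, consumed BY NAME; reader file `HOME/lit-balaban-r15/ROWS-C1.md`, owner
r15, referee ref-5).

THE PRINTED TEXT (verbatim, p. 326 [PDF 28]): *"The gauge transformation λ in (5.1.1) is bounded and depends on B through an exponentially
decaying kernel D_k: λ(x) = (D_kB)(x), |D_k(x, b)| ≤ Me^{−δdist(x,b)}. (7.2.4) This estimate follows from (5.1.4) and (7.2.2)."*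

WHAT IS PROVED (all theorems; no Prop-valued fact, no new hypothesis bundle).
* the torus kernel `H_{k,μν}(x; y) := H(⟨x,μ⟩, ⟨y,ν⟩)` of `torusRep P k D` in the function shape of `BIJ85Ineq724Proof`;
  `abs_H_torus_le` — p08's displayed hypothesis `hH` HOLDS for it: `|H_{k,μν}(x″; y)| ≤ const722·e^{−rate722·|x″_k − y|_∞}` (from
  `Rep103.abs_H_le` + `hyps_torus`; `x″_k = blk k x″ = iterBlockOf k x″` by `B6SectAOntoV1.blk_eq_iterBlockOf`).
* **`ineq724_torus_block`** — `KernelData.Ineq724 (Λ·const722) rate722` for p08's carrier with the torus `H` and the block distances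
  `|x″_k − y|_∞`, `|x_k − b₋|_∞` (`Λ = 2d((L−1)/2)Σ_{j<k}L^j/|c|`), given `TorusHyps P k D γ₁ q₀ q₁ r_Q` and `Prop12Hyps C Cα δ₀`.
* **`ineq724_torus`** — the same with the FINE-SITE distances of the torus, `|x − y| = |x − ctr y|_∞/L^k` (`BIJ85Ineq722Torus.distEU`) and
  `dist(x, b) = |x − b₋|` (slacks `s = s′ = ½`: `supDist_blk_le_distEU`, `distEU_le`), constant `Λ·(const722·e^{δ/2})·e^{δ}`, `δ = rate722`.
* **`ineq724_torusStd`** — with the (1.18) averaging operators (`stdData k G DG`): `KernelData.Ineq724` on the torus GIVEN ONLY `G` symmetric,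
  the lower bound (1.100) `γ₁‖w‖² ≤ ⟨w, QGQ^*w⟩`, and the three displayed members of [6I] Prop. 1.2 (`Prop12Hyps C Cα δ₀`).
* `ineq724_torusKernelData` — at the printed normalisation `c = L^k` the constant is independent of `k` (`Λ(L^k) = d(1 − L^{−k}) ≤ d`), for
  the carrier `BIJ85Ineq722Torus.torusKernelData … (Dk (L^k) k H)` (= p08's `kernelData` with the torus members, definitionally); and
  **`sect72_torusStd`** — ONE family of Sect. 7.2 carriers on the torus satisfying BOTH `KernelData.Ineq722` and `KernelData.Ineq724` with
  k-independent constants, given only `G_k` symmetric + (1.100) + Prop. 1.2.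
HONEST SCOPE.  As in `BIJ85Ineq722Torus`: [6I] Prop. 1.2 (row B5.Prop1.2, not proved in the tree), (1.100) and the symmetry of `G_k = G̃_k(ΩA)`
remain hypotheses of the printed shape; «λ is bounded» + locality are p08's PROVED `BIJ85GaugeFnBound513`; nothing of p08's files is edited.
Unit `lit-balaban-p09` (literature-prover-lit-balaban-p09-g4-0), 2026-08-21.
-/

namespace Literature.MathematicalPhysics.QuantumFieldTheory.BalabanImbrieJaffe1984to88.BIJ85Ineq724Torus

open Literature.MathematicalPhysics.QuantumFieldTheory.Balaban1983to89
open scoped BigOperators Matrix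
open LatticeFieldCalculus B3TorusRadialSums B5Eq118OneStroke
open BIJ85Ineq722Proof BIJ85Ineq722Proof.Rep103 BIJ85Ineq722ProofPart2 BIJ85Sect7Statements BIJ85Ineq722Torus
open BIJ85GaugeFunction5113 (blk)
open BIJ85Ineq724Proof (Dk kernelData ineq724_block ineq724)
open BIJ85GaugeFnBound513 (lamBound_unit)
open B6SectAOntoV1 (blk_eq_iterBlockOf)

noncomputable section

variable {P : Params} {k : ℕ} {D : TorusData P k} {γ₁ q₀ q₁ rQ C δ₀ : ℝ} {Cα : ℝ → ℝ}

/-- `0 < L^k` in `ℝ`. [folklore] -/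
private theorem cast_pow_L_pos' (k : ℕ) : (0 : ℝ) < (P.L : ℝ) ^ k := pow_pos P.cast_L_pos k

/-- **p08's displayed hypothesis `hH` holds for the torus kernel**: `|H_{k,μν}(x″; y)| ≤ const722·e^{−rate722·|x″_k − y|_∞}`, `x″_k = blk k x″`
(the `|H|`-member of (7.2.2) on the torus, `Rep103.abs_H_le` through `hyps_torus`; standing range). [cite: BalabanImbrieJaffe1985, (7.2.2) p.325] -/
theorem abs_H_torus_le (hk : k ≤ P.m + P.K) (h : TorusHyps P k D γ₁ q₀ q₁ rQ) (h12 : (torusRep P k D).Prop12Hyps C Cα δ₀)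
    (μ ν : Fin P.d) (x'' : Site P 0) (y : Site P k) :
    |(torusRep P k D).H (x'', μ) (y, ν)| ≤ const722 P.d C δ₀ γ₁ q₀ q₁ rQ (KYd P) *
      Real.exp (-(rate722 P.d C δ₀ γ₁ q₀ q₁ rQ (KYd P) * (supDist (blk k x'') y : ℝ))) := by
  have hc : Fintype.card (torusRep P k D).Dir = P.d := Fintype.card_fin P.d
  have h1 := abs_H_le (hyps_torus hk h) h12 (x'', μ) (y, ν)
  rw [hc] at h1
  rw [blk_eq_iterBlockOf k x'']
  exact h1

/-- **(7.2.4) ON THE TORUS, block distances**: `KernelData.Ineq724 (Λ·const722) rate722` for p08's carrier with the torus kernel `H_k`,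
`|x″ − y| := |x″_k − y|_∞`, `dist(x, b) := |x_k − b₋|_∞` — `BIJ85Ineq724Proof.ineq724_block` fed with `abs_H_torus_le`.
[cite: BalabanImbrieJaffe1985, (7.2.4) p.326] -/
theorem ineq724_torus_block (hk : k ≤ P.m + P.K) (h : TorusHyps P k D γ₁ q₀ q₁ rQ) (h12 : (torusRep P k D).Prop12Hyps C Cα δ₀) (c : ℝ)
    (gradH : Fin P.d → Fin P.d → Site P 0 → Site P k → ℝ) (gradHDiff : Fin P.d → Fin P.d → Site P 0 → Site P 0 → Site P k → ℝ)
    (Ck : Fin P.d → Fin P.d → Site P k → Site P k → ℝ) (distEta : Site P 0 → Site P 0 → ℝ) (distU : Site P k → Site P k → ℝ) :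
    (kernelData k c (fun μ ν x y => (torusRep P k D).H (x, μ) (y, ν)) gradH gradHDiff Ck
        (fun x'' y => (supDist (blk k x'') y : ℝ)) distEta distU
        (fun x b => (supDist (blk k x) b.src : ℝ))).Ineq724
      ((2 * ((P.d * ((P.L - 1) / 2) : ℕ) : ℝ) * (∑ j ∈ Finset.range k, (P.L : ℝ) ^ j) / |c|) *
        const722 P.d C δ₀ γ₁ q₀ q₁ rQ (KYd P)) (rate722 P.d C δ₀ γ₁ q₀ q₁ rQ (KYd P)) :=
  ineq724_block hk c (fun μ ν x y => (torusRep P k D).H (x, μ) (y, ν)) gradH gradHDiff Ck (fun y₁ y => (supDist y₁ y : ℝ))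
    distEta distU (const722_nonneg (hyps_torus hk h) h12 P.d) (abs_H_torus_le hk h h12)

/-- `|x″_k − y|_∞ ≤ |x″ − y| + ½` for the fine-site distance `|x″ − y| = |x″ − ctr y|_∞/L^k` (through the two block centres).
[cite: BalabanImbrieJaffe1985, (7.2.2) p.325] -/
theorem supDist_blk_le_distEU (hk : k ≤ P.m + P.K) (x'' : Site P 0) (y : Site P k) :
    (supDist (blk k x'') y : ℝ) ≤ distEU P k x'' y + 1 / 2 := by
  rw [blk_eq_iterBlockOf k x'', distEU]
  have hL := cast_pow_L_pos' (P := P) k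
  rw [← mul_le_mul_iff_of_pos_left hL]
  have h1 : P.L ^ k * supDist (iterBlockOf k x'') y ≤ supDist x'' (ctr k y) + (P.L ^ k - 1) / 2 := by
    rw [← supDist_ctr_ctr hk]
    have h2 := supDist_triangle (ctr k (iterBlockOf k x'')) x'' (ctr k y)
    have h3 := supDist_ctr_blk_le hk x''
    rw [supDist_comm] at h3
    omega
  have h4 : 2 * (P.L ^ k * supDist (iterBlockOf k x'') y) ≤ 2 * supDist x'' (ctr k y) + P.L ^ k := by
    have := Nat.one_le_pow k P.L P.L_pos; omega
  have h5 : (2 : ℝ) * ((P.L : ℝ) ^ k * (supDist (iterBlockOf k x'') y : ℝ)) ≤ 2 * (supDist x'' (ctr k y) : ℝ) + (P.L : ℝ) ^ k := by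
    exact_mod_cast h4
  have h6 : (P.L : ℝ) ^ k * ((supDist x'' (ctr k y) : ℝ) / (P.L : ℝ) ^ k + 1 / 2) = (supDist x'' (ctr k y) : ℝ) + (P.L : ℝ) ^ k / 2 := by
    field_simp
  rw [h6]
  linarith

/-- **(7.2.4) ON THE TORUS with the fine-site distances**: `|x − y| := |x − ctr y|_∞/L^k` (`BIJ85Ineq722Torus.distEU`), `dist(x, b) := |x − b₋|`,
any `|x − x′|`, `|y − y′|`: `KernelData.Ineq724 (Λ·(const722·e^{δ/2})·e^{δ(½+½)}) δ`, `δ = rate722` — `BIJ85Ineq724Proof.ineq724` with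
`s = s′ = ½`. [cite: BalabanImbrieJaffe1985, (7.2.4) p.326] -/
theorem ineq724_torus (hk : k ≤ P.m + P.K) (h : TorusHyps P k D γ₁ q₀ q₁ rQ) (h12 : (torusRep P k D).Prop12Hyps C Cα δ₀) (c : ℝ)
    (gradH : Fin P.d → Fin P.d → Site P 0 → Site P k → ℝ) (gradHDiff : Fin P.d → Fin P.d → Site P 0 → Site P 0 → Site P k → ℝ)
    (Ck : Fin P.d → Fin P.d → Site P k → Site P k → ℝ) (distEta : Site P 0 → Site P 0 → ℝ) (distU : Site P k → Site P k → ℝ) :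
    (kernelData k c (fun μ ν x y => (torusRep P k D).H (x, μ) (y, ν)) gradH gradHDiff Ck (distEU P k) distEta distU
        (fun x b => distEU P k x b.src)).Ineq724
      ((2 * ((P.d * ((P.L - 1) / 2) : ℕ) : ℝ) * (∑ j ∈ Finset.range k, (P.L : ℝ) ^ j) / |c|) *
        (const722 P.d C δ₀ γ₁ q₀ q₁ rQ (KYd P) * Real.exp (rate722 P.d C δ₀ γ₁ q₀ q₁ rQ (KYd P) * (1 / 2))) *
        Real.exp (rate722 P.d C δ₀ γ₁ q₀ q₁ rQ (KYd P) * (1 / 2 + 1 / 2)))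
      (rate722 P.d C δ₀ γ₁ q₀ q₁ rQ (KYd P)) := by
  have hδ : 0 ≤ rate722 P.d C δ₀ γ₁ q₀ q₁ rQ (KYd P) := (rate722_pos (hyps_torus hk h) h12 P.d).le
  have hM : 0 ≤ const722 P.d C δ₀ γ₁ q₀ q₁ rQ (KYd P) := const722_nonneg (hyps_torus hk h) h12 P.d
  refine ineq724 hk c (fun μ ν x y => (torusRep P k D).H (x, μ) (y, ν)) gradH gradHDiff Ck (distEU P k) distEta distU
    (fun x b => distEU P k x b.src)
    (fun y₁ y => (supDist y₁ y : ℝ)) (by positivity) hδ (fun x'' y => supDist_blk_le_distEU hk x'' y) (fun x b => ?_) ?_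
  · -- `dist(x, b) = |x − b₋| ≤ |x_k − b₋|_∞ + ½`
    have h1 := distEU_le (D := D) hk x b.src
    rw [torusRep_dY, torusRep_blk, ← blk_eq_iterBlockOf k x] at h1
    exact h1
  · -- `|H| ≤ (const722·e^{δ/2})·e^{−δ|x″ − y|}` from `abs_H_torus_le` and `|x″_k − y|_∞ ≥ |x″ − y| − ½`
    intro μ ν x'' y
    refine (abs_H_torus_le hk h h12 μ ν x'' y).trans ?_
    rw [mul_assoc, ← Real.exp_add]
    refine mul_le_mul_of_nonneg_left (Real.exp_le_exp.mpr ?_) hM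
    have h1 := distEU_le (D := D) hk x'' y
    rw [torusRep_dY, torusRep_blk, ← blk_eq_iterBlockOf k x''] at h1
    nlinarith [mul_le_mul_of_nonneg_left h1 hδ]

/-- **(7.2.4) ON THE TORUS WITH THE AVERAGING OPERATORS OF (1.18)**, GIVEN ONLY `G` symmetric ([6I] Prop. 1.1), the lower bound (1.100) at
`γ₁`, and the three displayed members of [6I] Prop. 1.2: `KernelData.Ineq724` for the carrier of `BIJ85Ineq724Proof` with the torus kernel
`H_k = GQ^*(QGQ^*)⁻¹`, `Q^* = QsStd`, and the fine-site distances — the printed *"This estimate follows from (5.1.4) and (7.2.2)"* with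
(7.2.2) itself derived from [6I] on the torus. [cite: BalabanImbrieJaffe1985, (7.2.4) p.326] -/
theorem ineq724_torusStd (hk : k ≤ P.m + P.K) {G : Matrix (Site P 0 × Fin P.d) (Site P 0 × Fin P.d) ℝ}
    {DG : Matrix (Site P 0 × Fin P.d × Fin P.d) (Site P 0 × Fin P.d) ℝ} (hγ : 0 < γ₁) (hG : G.IsSymm)
    (hM : ∀ w : Site P k × Fin P.d → ℝ, γ₁ * ∑ p, w p ^ 2 ≤ ∑ p, w p * ((torusRep P k (stdData k G DG)).M *ᵥ w) p)
    (h12 : (torusRep P k (stdData k G DG)).Prop12Hyps C Cα δ₀) (c : ℝ)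
    (gradH : Fin P.d → Fin P.d → Site P 0 → Site P k → ℝ) (gradHDiff : Fin P.d → Fin P.d → Site P 0 → Site P 0 → Site P k → ℝ)
    (Ck : Fin P.d → Fin P.d → Site P k → Site P k → ℝ) (distEta : Site P 0 → Site P 0 → ℝ) (distU : Site P k → Site P k → ℝ) :
    (kernelData k c (fun μ ν x y => (torusRep P k (stdData k G DG)).H (x, μ) (y, ν)) gradH gradHDiff Ck (distEU P k)
        distEta distU (fun x b => distEU P k x b.src)).Ineq724
      ((2 * ((P.d * ((P.L - 1) / 2) : ℕ) : ℝ) * (∑ j ∈ Finset.range k, (P.L : ℝ) ^ j) / |c|) *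
        (const722 P.d C δ₀ γ₁ 1 1 1 (KYd P) * Real.exp (rate722 P.d C δ₀ γ₁ 1 1 1 (KYd P) * (1 / 2))) *
        Real.exp (rate722 P.d C δ₀ γ₁ 1 1 1 (KYd P) * (1 / 2 + 1 / 2)))
      (rate722 P.d C δ₀ γ₁ 1 1 1 (KYd P)) :=
  ineq724_torus hk (torusHyps_std hk hγ hG hM) h12 c gradH gradHDiff Ck distEta distU

/-! ## One Sect. 7.2 carrier on the torus: (7.2.2) and (7.2.4) together, constants independent of `k` -/

/-- `Ineq724` is monotone in the constant. [cite: BalabanImbrieJaffe1985, (7.2.4) p.326] -/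
theorem ineq724_mono (K : KernelData) {M M' δ : ℝ} (h : K.Ineq724 M δ) (hM : M ≤ M') : K.Ineq724 M' δ :=
  fun x b => (h x b).trans (mul_le_mul_of_nonneg_right hM (Real.exp_pos _).le)

/-- **(7.2.4) on the torus at the printed normalisation `c = η⁻¹ = L^k`, constant independent of `k`**: for the Sect. 7.2 carrier of
`BIJ85Ineq722Torus` (`torusKernelData`, unit bonds `PBond P k`, `dist(x, b) = |x − b₋|`) with `D := D_k = λ(H_k(·; b))(x)` of
`BIJ85Ineq724Proof` — the SAME structure as p08's `kernelData` with the torus members — `|D_k(x, b)| ≤ d·const722·e^{3δ/2}·e^{−δ·dist(x,b)}`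
(`Λ(L^k) = d(1 − L^{−k}) ≤ d`, `BIJ85GaugeFnBound513.lamBound_unit`). [cite: BalabanImbrieJaffe1985, (7.2.4) p.326] -/
theorem ineq724_torusKernelData (hk : k ≤ P.m + P.K) (h : TorusHyps P k D γ₁ q₀ q₁ rQ) (h12 : (torusRep P k D).Prop12Hyps C Cα δ₀)
    (Ck : Fin P.d → Fin P.d → Site P k → Site P k → ℝ) :
    (torusKernelData P k D (PBond P k) (fun x b => distEU P k x b.src) Ck
        (Dk ((P.L : ℝ) ^ k) k (fun μ ν x y => (torusRep P k D).H (x, μ) (y, ν)))).Ineq724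
      (P.d * (const722 P.d C δ₀ γ₁ q₀ q₁ rQ (KYd P) * Real.exp (rate722 P.d C δ₀ γ₁ q₀ q₁ rQ (KYd P) * (1 / 2))) *
        Real.exp (rate722 P.d C δ₀ γ₁ q₀ q₁ rQ (KYd P) * (1 / 2 + 1 / 2)))
      (rate722 P.d C δ₀ γ₁ q₀ q₁ rQ (KYd P)) := by
  have h1 := ineq724_torus hk h h12 ((P.L : ℝ) ^ k)
    (fun μ ν x y => ‖fun lam : Fin P.d => (torusRep P k D).gradH (x, lam, μ) (y, ν)‖)
    (fun μ ν x x' y => ‖fun lam : Fin P.d => (torusRep P k D).gradH (x, lam, μ) (y, ν) - (torusRep P k D).gradH (x', lam, μ) (y, ν)‖)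
    Ck (torusRep P k D).dS (torusRep P k D).dY
  rw [lamBound_unit] at h1
  have hM : 0 ≤ const722 P.d C δ₀ γ₁ q₀ q₁ rQ (KYd P) * Real.exp (rate722 P.d C δ₀ γ₁ q₀ q₁ rQ (KYd P) * (1 / 2)) :=
    mul_nonneg (const722_nonneg (hyps_torus hk h) h12 P.d) (Real.exp_pos _).le
  have hd : (P.d : ℝ) * (1 - ((P.L : ℝ) ^ k)⁻¹) ≤ P.d :=
    mul_le_of_le_one_right (Nat.cast_nonneg _) (by have := inv_nonneg.mpr (cast_pow_L_pos' (P := P) k).le; linarith)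
  exact ineq724_mono _ h1 (mul_le_mul_of_nonneg_right (mul_le_mul_of_nonneg_right hd hM) (Real.exp_pos _).le)

/-- **SECT. 7.2, FIRST PARAGRAPH, ON THE TORUS WITH THE AVERAGING OPERATORS OF (1.18)** — for ONE family of Sect. 7.2 carriers (the torus
kernel `H_k = GQ^*(QGQ^*)⁻¹` of [6I] (1.103), `|∇H_k|`, `|∇H_k − ∇H_k′|`, `D_k = λ(H_k(·; b))(x)` of (5.1.13) at `c = L^k`, the fine-site
distances, `C^{(k)}` a parameter) BOTH typed displays hold with constants INDEPENDENT OF `k`: (7.2.2) `KernelData.Ineq722` and (7.2.4)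
`KernelData.Ineq724 (d·const722·e^{3δ/2}) δ` at every scale — GIVEN ONLY `G_k` symmetric ([6I] Prop. 1.1), the lower bound (1.100) at a
k-independent `γ₁`, and the three displayed members of [6I] Prop. 1.2 (`Prop12Hyps C Cα δ₀`). [cite: BalabanImbrieJaffe1985, (7.2.2) p.325] -/
theorem sect72_torusStd (lev : ℕ → ℕ) (hlev : ∀ k, lev k ≤ P.m + P.K)
    (G : (k : ℕ) → Matrix (Site P 0 × Fin P.d) (Site P 0 × Fin P.d) ℝ)
    (DG : (k : ℕ) → Matrix (Site P 0 × Fin P.d × Fin P.d) (Site P 0 × Fin P.d) ℝ)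
    (Ck : (k : ℕ) → Fin P.d → Fin P.d → Site P (lev k) → Site P (lev k) → ℝ) (hγ : 0 < γ₁) (hG : ∀ k, (G k).IsSymm)
    (hM : ∀ (k : ℕ) (w : Site P (lev k) × Fin P.d → ℝ),
      γ₁ * ∑ p, w p ^ 2 ≤ ∑ p, w p * ((torusRep P (lev k) (stdData (lev k) (G k) (DG k))).M *ᵥ w) p)
    (h12 : ∀ k, (torusRep P (lev k) (stdData (lev k) (G k) (DG k))).Prop12Hyps C Cα δ₀) :
    KernelData.Ineq722 (fun k => torusKernelData P (lev k) (stdData (lev k) (G k) (DG k)) (PBond P (lev k))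
        (fun x b => distEU P (lev k) x b.src) (Ck k)
        (Dk ((P.L : ℝ) ^ lev k) (lev k) (fun μ ν x y => (torusRep P (lev k) (stdData (lev k) (G k) (DG k))).H (x, μ) (y, ν)))) ∧
    ∀ k, (torusKernelData P (lev k) (stdData (lev k) (G k) (DG k)) (PBond P (lev k)) (fun x b => distEU P (lev k) x b.src) (Ck k)
        (Dk ((P.L : ℝ) ^ lev k) (lev k) (fun μ ν x y => (torusRep P (lev k) (stdData (lev k) (G k) (DG k))).H (x, μ) (y, ν)))).Ineq724
      (P.d * (const722 P.d C δ₀ γ₁ 1 1 1 (KYd P) * Real.exp (rate722 P.d C δ₀ γ₁ 1 1 1 (KYd P) * (1 / 2))) *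
        Real.exp (rate722 P.d C δ₀ γ₁ 1 1 1 (KYd P) * (1 / 2 + 1 / 2)))
      (rate722 P.d C δ₀ γ₁ 1 1 1 (KYd P)) :=
  ⟨ineq722_torusStd lev hlev G DG (fun k => PBond P (lev k)) (fun k x b => distEU P (lev k) x b.src) Ck
      (fun k => Dk ((P.L : ℝ) ^ lev k) (lev k) (fun μ ν x y => (torusRep P (lev k) (stdData (lev k) (G k) (DG k))).H (x, μ) (y, ν)))
      hγ hG hM h12,
    fun k => ineq724_torusKernelData (hlev k) (torusHyps_std (hlev k) hγ (hG k) (hM k)) (h12 k) (Ck k)⟩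

end

end Literature.MathematicalPhysics.QuantumFieldTheory.BalabanImbrieJaffe1984to88.BIJ85Ineq724Torus
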